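import Summits.QuantumFields.YangMills.Theorems.BalabanUVNodesN19VacuumK5MGFRoad

/-!
# BalabanUVNodes ∕ N19 at cluster K5 — GUARD for the vacuum ∕ MGF road: the joint binder list of
# `N19VacuumK5MGFRoad.hybridNE7_dressed_of_vacuumK5_mgfForm` (and of its node-U5 exit) INHABITED on a convergent toy tower

Cell `pub-ymgap` (HUMAN RULING D-0062, Track A), node N19 = NE7, R134 seat `pub-ymgap-dag-n19-c` (g5); sibling WITNESS file of
`Thm/BalabanUVNodesN19VacuumK5MGFRoad.lean` (p482897, lens ROW VL-K5); filed `--supports` K3′ «SpineGivenEndpointR12» (stmt-QuantumFields-19908)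
`--as helper`.  COUNT-NEUTRAL.  THEOREMS ONLY; no Theses import; edits nothing.

THE TOY (nothing of Bałaban's is modelled).  ONE term class (`ι = Unit`, `T K = {()}`), NO bad classes (`Bad K t = ∅`), NO shell parts (`shA = shB = 0`,
shell measures `0`); one-point field spaces `Ω K = Ω′ K = Unit` with DIRAC class laws; CONSTANT observables forming a convergent tower of levels
`a_K = a + 2 − 2·2^{−K}`: run A (depth `K`) reads `a_K`, run B (depth `K+1`) reads `a_{K+1} = a + 2 − 2^{−K}`, both bounded by `Bo = |a| + 2`.
Then the dressed term families ARE the MGFs `A K t () = e^{t·a_K}`, `B K t () = e^{t·a_{K+1}}` (`ProbabilityTheory.mgf_const`), the VACUUM families are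
`≡ 1`, and:
* the vacuum K5 datum holds with `W₀ = Wsh₀ = δ⁰ = 0` (N20⁰ ∕ N21⁰ trivially — no bad class, no shell; N19⁰ with constants `c_K = 0`);
* the gen-0 room `e^{2l₀Bo}·(0 + 0) < 1` holds;
* N14's binder holds NON-DEGENERATELY: the tilted means are `a_K` and `a_{K+1}` (`TiltedMeanCrossover.tiltedMean_const_dirac`), so
  `TiltedMeanMatching … η` with `η K = a_{K+1} − a_K = 2^{−K}` EXACTLY, summable (`summable_geometric_two`);
so `hybridNE7_dressed_of_vacuumK5_mgfForm` FIRES and returns the dressed `HybridNE7` datum with weights `e^{2l₀Bo}·0` and remainder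
`0 + (l₀∕vol)·2^{−K}` (§1, raw and simplified forms) — a TRUE and, on the N19 side, SHARP statement: the dressed cores differ by the factor
`e^{t·2^{−K}}`, `|t| ≤ l₀`, i.e. exactly `e^{±vol·δ_K}` with `δ_K = (l₀∕vol)·2^{−K}`.  With the dictionary `Z K t = e^{t·a_K}` (the toy tower's «dressed
partition functions», consistent across depths: `Z (K+1) t = Σ B K t = Σ A (K+1) t`) node U5's exit `target_dressed_of_vacuumK5_mgfForm` FIRES too (§2):
`Spine.NE7.Target vol l₀ δ′ Z` — the toy tower's partition functions match modulo constants with a summable remainder, as they visibly do.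
The N20 ∕ N21 halves are inhabited only degenerately here (zero weights); their non-degenerate witnesses are the n20 ∕ n21 lineages' own toys.

* §0 `mgfForm_const_dirac` · `mgfForm_zero` · `abs_toyLevel_le`.
* §1 `toy_hybridNE7_dressed_of_vacuumK5` (raw form, exactly as §1 (c) of the main file returns it) · `toy_hybridNE7_dressed_of_vacuumK5'` (weights `0`,
  remainder `(l₀∕vol)·2^{−K}`).
* §2 `toy_target_dressed_of_vacuumK5` (node U5's exit on the toy tower).

HONEST FRAMING.  A decided toy: joint inhabitation of a binder list, non-vacuous firing of two landed bookkeeping theorems; no content about Bałaban's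
runs; NE7 ∕ NE7b ∕ NE7c ∕ NE1′ NOT proved; N19 ∕ N20 ∕ N21 NOT discharged; counts UNMOVED (5∕27 · A 5∕28); one finite four-torus programme — NOT ℝ⁴, NOT
OS, NOT a mass gap, NOT Clay.  0 `def`; 0 `sorry`; standard axioms; [folklore] throughout.
-/

set_option autoImplicit false

noncomputable section

open Finset MeasureTheory ProbabilityTheory
open scoped BigOperators

namespace Summit.QuantumFields.YangMills.BalabanUVNodes.N19VacuumK5MGFRoadWitness

open Literature.MathematicalPhysics.QuantumFieldTheory.Balaban1983to89
open Literature.MathematicalPhysics.QuantumFieldTheory.Balaban1983to89.T4WeightBudget (RelWeightBound)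
open Literature.MathematicalPhysics.QuantumFieldTheory.Balaban1983to89.T4IndicatorShell (ShellWeightBound)
open Literature.MathematicalPhysics.QuantumFieldTheory.Balaban1983to89.T4MatchingAssembly (HybridNE7)
open Summit.QuantumFields.BalabanUV.T4Continuum.Spine
open Summit.QuantumFields.BalabanUV.T4Continuum.NE1p.DressedMGFForm (MGFForm TiltedMeanMatching tiltedMean)
open Summit.QuantumFields.BalabanUV.T4Continuum.NE1p.TiltedMeanCrossover (tiltedMean_const_dirac)
open Summit.QuantumFields.YangMills.BalabanUVNodes.N19VacuumK5MGFRoad (hybridNE7_dressed_of_vacuumK5_mgfForm target_dressed_of_vacuumK5_mgfForm)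

/-! ## §0 The toy's two elementary facts -/

/-- A CONSTANT observable under a DIRAC class law: the dressed term total `e^{t·c}` IS the MGF — `MGFForm` for the one-class toy carriers, any bound
`Bo ≥ |c K|`. [folklore] -/
theorem mgfForm_const_dirac {c : ℕ → ℝ} {Bo : ℝ} (hBo : ∀ K, |c K| ≤ Bo) :
    MGFForm (Ω := fun _ => Unit) Bo (fun _ => ({()} : Finset Unit)) (fun K _ => c K) (fun _ _ => Measure.dirac ())
      (fun K t _ => Real.exp (t * c K)) where
  nonneg := (abs_nonneg _).trans (hBo 0)
  meas _ := measurable_const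
  bound K _ := hBo K
  finite _ _ _ := by infer_instance
  repr K t _ _ := (mgf_const (μ := Measure.dirac ()) (t := t) (c K)).symm

/-- … and over the ZERO measure (no shell part) the MGF form holds with total `0` (`mgf_zero_measure`). [folklore] -/
theorem mgfForm_zero {c : ℕ → ℝ} {Bo : ℝ} (hBo : ∀ K, |c K| ≤ Bo) :
    MGFForm (Ω := fun _ => Unit) Bo (fun _ => ({()} : Finset Unit)) (fun K _ => c K) (fun _ _ => (0 : Measure Unit))
      (fun _ _ _ => (0 : ℝ)) where
  nonneg := (abs_nonneg _).trans (hBo 0)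
  meas _ := measurable_const
  bound K _ := hBo K
  finite _ _ _ := by infer_instance
  repr K t _ _ := by rw [mgf_zero_measure, Pi.zero_apply]

/-- The toy levels are bounded: `|a + 2 − 2·2^{−K}| ≤ |a| + 2` and `|a + 2 − 2^{−K}| ≤ |a| + 2`. [folklore] -/
theorem abs_toyLevel_le (a : ℝ) (K : ℕ) :
    |a + 2 - 2 * (1 / 2 : ℝ) ^ K| ≤ |a| + 2 ∧ |a + 2 - (1 / 2 : ℝ) ^ K| ≤ |a| + 2 := by
  have h0 : (0 : ℝ) ≤ (1 / 2 : ℝ) ^ K := by positivity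
  have h1 : (1 / 2 : ℝ) ^ K ≤ 1 := pow_le_one₀ (by norm_num) (by norm_num)
  constructor <;>
  · refine abs_le.mpr ⟨?_, ?_⟩ <;> cases abs_cases a <;> linarith

/-! ## §1 The K5 transfer fires on the toy tower -/

/-- **GUARD — `hybridNE7_dressed_of_vacuumK5_mgfForm` FIRES, NON-DEGENERATELY ON THE N19 SIDE** [decided toy].  One class, no bad class, no shells,
Dirac class laws on one-point field spaces, constant observables `a_K = a + 2 − 2·2^{−K}` (run A) and `a_{K+1} = a + 2 − 2^{−K}` (run B) bounded by
`|a| + 2`: the vacuum K5 datum holds with `W₀ = Wsh₀ = δ⁰ = 0`, the room holds, the MGF forms hold (`mgfForm_const_dirac`, `mgfForm_zero`), and N14's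
binder holds with `η K = 2^{−K}` EXACTLY (`tiltedMean_const_dirac`; summable) — so the main file's §1 (c) returns the dressed `HybridNE7` datum for
`A K t () = e^{t·a_K}`, `B K t () = e^{t·a_{K+1}}`, stated here exactly as returned (weights `e^{2l₀(|a|+2)}·0`, remainder `0 + (l₀∕vol)·2^{−K}`). -/
theorem toy_hybridNE7_dressed_of_vacuumK5 (a l₀ vol : ℝ) (hl₀ : 0 ≤ l₀) (hvol : 0 < vol) :
    HybridNE7 l₀ vol (fun _ => ({()} : Finset Unit))
      (fun K t _ => Real.exp (t * (a + 2 - 2 * (1 / 2 : ℝ) ^ K))) (fun K t _ => Real.exp (t * (a + 2 - (1 / 2 : ℝ) ^ K)))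
      (fun _ _ => ∅) (fun _ => Real.exp (2 * l₀ * (|a| + 2)) * 0) (fun _ _ _ => 0) (fun _ _ _ => 0)
      (fun _ => Real.exp (2 * l₀ * (|a| + 2)) * 0) (fun K => 0 + l₀ / vol * (1 / 2 : ℝ) ^ K) := by
  have hbA : ∀ K, |a + 2 - 2 * (1 / 2 : ℝ) ^ K| ≤ |a| + 2 := fun K => (abs_toyLevel_le a K).1
  have hbB : ∀ K, |a + 2 - (1 / 2 : ℝ) ^ K| ≤ |a| + 2 := fun K => (abs_toyLevel_le a K).2
  refine hybridNE7_dressed_of_vacuumK5_mgfForm (Ω := fun _ => Unit) (Ω' := fun _ => Unit) (Bo := |a| + 2)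
    (Fo := fun K _ => a + 2 - 2 * (1 / 2 : ℝ) ^ K) (ν := fun _ _ => Measure.dirac ()) (νsh := fun _ _ => (0 : Measure Unit))
    (Fo' := fun K _ => a + 2 - (1 / 2 : ℝ) ^ K) (ν' := fun _ _ => Measure.dirac ()) (νsh' := fun _ _ => (0 : Measure Unit))
    (W₀ := fun _ => 0) (Wsh₀ := fun _ => 0) (δ₀ := fun _ => 0) (η := fun K => (1 / 2 : ℝ) ^ K)
    hvol hl₀ (mgfForm_const_dirac hbA) (mgfForm_const_dirac hbB) (mgfForm_zero hbA) (mgfForm_zero hbB)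
    (fun _ _ _ => Measure.zero_le _) (fun _ _ _ => Measure.zero_le _) ?_ ?_ (fun _ => by norm_num) summable_zero ?_
    (fun _ => by norm_num) ?_ summable_geometric_two
  · -- N20⁰: no bad class, weight 0
    exact { bad_subset := fun _ _ _ => Finset.empty_subset _
            nonneg := fun _ => le_rfl
            lt_one := fun _ => zero_lt_one
            summable := summable_zero
            bad_left := fun _ _ _ => by simp
            bad_right := fun _ _ _ => by simp }
  · -- N21⁰: no shell part, weight 0
    exact { nonneg := fun _ => le_rfl
            summable := summable_zero
            sh_nonneg_left := fun _ _ _ _ _ => le_rfl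
            sh_le_left := fun _ _ _ _ _ => (Real.exp_pos _).le
            sh_nonneg_right := fun _ _ _ _ _ => le_rfl
            sh_le_right := fun _ _ _ _ _ => (Real.exp_pos _).le
            left := fun _ _ _ => by simp
            right := fun _ _ _ => by simp }
  · -- N19⁰: the vacuum cores are both `1`, constants `c_K = 0`
    intro K
    refine ⟨0, fun t _ τ _ => ?_⟩
    simp
  · -- N14's binder, exactly: the tilted means are the levels `a_{K+1}` and `a_K`
    intro K t _ τ _ s _
    show |tiltedMean (fun _ : Unit => a + 2 - (1 / 2 : ℝ) ^ K) (Measure.dirac () - 0) s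
        - tiltedMean (fun _ : Unit => a + 2 - 2 * (1 / 2 : ℝ) ^ K) (Measure.dirac () - 0) s| ≤ (1 / 2 : ℝ) ^ K
    rw [Measure.sub_zero, tiltedMean_const_dirac, tiltedMean_const_dirac]
    have h0 : (0 : ℝ) ≤ (1 / 2 : ℝ) ^ K := by positivity
    rw [abs_of_nonneg (by linarith)]
    linarith

/-- **… SIMPLIFIED**: the same dressed `HybridNE7` datum with weights `0` and remainder `δ_K = (l₀∕vol)·2^{−K}` — SHARP on the toy: the dressed cores
differ exactly by `e^{t·2^{−K}}`, `|t| ≤ l₀`, i.e. by `e^{±vol·δ_K}`. [decided toy] -/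
theorem toy_hybridNE7_dressed_of_vacuumK5' (a l₀ vol : ℝ) (hl₀ : 0 ≤ l₀) (hvol : 0 < vol) :
    HybridNE7 l₀ vol (fun _ => ({()} : Finset Unit))
      (fun K t _ => Real.exp (t * (a + 2 - 2 * (1 / 2 : ℝ) ^ K))) (fun K t _ => Real.exp (t * (a + 2 - (1 / 2 : ℝ) ^ K)))
      (fun _ _ => ∅) (fun _ => 0) (fun _ _ _ => 0) (fun _ _ _ => 0) (fun _ => 0) (fun K => l₀ / vol * (1 / 2 : ℝ) ^ K) := by
  simpa only [mul_zero, zero_add] using toy_hybridNE7_dressed_of_vacuumK5 a l₀ vol hl₀ hvol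

/-! ## §2 Node U5's exit fires on the toy tower -/

/-- **GUARD — `target_dressed_of_vacuumK5_mgfForm` FIRES** [decided toy]: with the toy tower's «dressed partition functions» `Z K t = e^{t·a_K}` — the class
sums of run A at depth `K` AND of run B at depth `K − 1` (`2·2^{−(K+1)} = 2^{−K}`, one `ring`), positive — node U5's exit returns `Spine.NE7.Target vol l₀ δ′ Z`
(`T4CauchySum.MatchingModConstants ∧ Summable`) with `δ′ = hybridDelta vol (0 + (l₀∕vol)·2^{−K}) (e^{2l₀(|a|+2)}·0 + e^{2l₀(|a|+2)}·0)`; visibly true: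
`log Z (K+1) t − log Z K t = t·2^{−K}`. -/
theorem toy_target_dressed_of_vacuumK5 (a l₀ vol : ℝ) (hl₀ : 0 ≤ l₀) (hvol : 0 < vol) :
    NE7.Target vol l₀
      (T4HybridMatching.hybridDelta vol (fun K => 0 + l₀ / vol * (1 / 2 : ℝ) ^ K)
        (fun _ => Real.exp (2 * l₀ * (|a| + 2)) * 0 + Real.exp (2 * l₀ * (|a| + 2)) * 0))
      (fun K t => Real.exp (t * (a + 2 - 2 * (1 / 2 : ℝ) ^ K))) := by
  have h := toy_hybridNE7_dressed_of_vacuumK5 a l₀ vol hl₀ hvol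
  refine NE7.target_of_hybridNE7 h hvol hl₀ (fun K t _ => by simp) (fun K t _ => ?_) (fun K t _ => by simp [Real.exp_pos])
  -- the toy tower's step `2·2^{−(K+1)} = 2^{−K}` (the tree's `DyadicCascadeUniqueness.two_mul_half_pow_succ`, inlined — not imported)
  rw [sum_singleton, pow_succ]
  congr 1
  ring

end Summit.QuantumFields.YangMills.BalabanUVNodes.N19VacuumK5MGFRoadWitness

end
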